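import Literature.NumberTheory.NumberFields.CyclotomicTwoPowerOddNarrowClassNumber
import Literature.NumberTheory.NumberFields.CyclotomicTwoPowerPrimesOverBound
import Literature.NumberTheory.NumberFields.CMFieldTwoRankOfTotPosSquares
import Literature.NumberTheory.NumberFields.HasseUnitIndexOddNarrowClassNumber
import Literature.NumberTheory.NumberFields.SplitPrimesBaseChange
import Literature.NumberTheory.NumberFields.SplitPrimesGaloisClosure
import Literature.NumberTheory.IwasawaTheory.ClassicalMuVanishesIffBoundedRank
import Literature.NumberTheory.IwasawaTheory.ClassicalMuVanishesNormRelationTower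
import Literature.NumberTheory.IwasawaTheory.ClassicalMuVanishesReflectionLayer
import Literature.NumberTheory.IwasawaTheory.ClassicalMuVanishesSubextension
import Literature.NumberTheory.IwasawaTheory.ClassicalMuInvariantOnePrimeProofs
import Literature.NumberTheory.EllipticCurves.ZpExtensionRestrictLayers
import Literature.NumberTheory.EllipticCurves.ZpExtensionRestrictCyclotomic
import Literature.NumberTheory.EllipticCurves.ZpExtensionRestrictTwoSqrtTwo
import Literature.NumberTheory.EllipticCurves.ZpExtensionUnitTwistProofs
import Literature.NumberTheory.EllipticCurves.CyclotomicZpExtensionLayerTwoProofs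
import Literature.NumberTheory.EllipticCurves.HeegnerPointsImaginaryQuadraticProofs
import Literature.NumberTheory.QuadraticFields.SquareRootGenerator
import Mathlib.NumberTheory.NumberField.CMField
import Mathlib.RingTheory.RootsOfUnity.AlgebraicallyClosed
import HarnessLib

/-!
# Iwasawa's `μ = 0` for the cyclotomic `ℤ₂`-extension of an IMAGINARY QUADRATIC field, by genus theory (Kida 1979 / Ferrero 1980)

Topic `NumberTheory/IwasawaTheory` (namespace = path).  THEOREM-ONLY file (no definition, no named fact, no instance, no `sorry`), prover seat
`bsd-2adic-conv-1` GEN 33 (cell `bsd-2adic`; pen RC-450 key «FW-IQ-GENUS», `--supports` stmt-BirchSwinnertonDyer-19556).  WHY: the S3 crux line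
`kato_determinant_greenberg_two` of `OrdLambdaHalfAtTwo` consumes Ferrero–Washington ONLY as «`ClassicalMuVanishes κK` for the cyclotomic
`ℤ₂`-extension `κK` of ONE imaginary quadratic field `K`» (its v4.9 stub `stub_iqMuVanishesAtTwo`); that instance is elementary and is PROVED here:
* §1–§2: the layers `ℚ_n = κ.layer n` of a cyclotomic `ℤ₂`-extension `κ` of `ℚ` are totally real, `ℚ_n ⊆ ℚ(ζ_{2^{n+2}}) ⊆ ℚ̄` with index `2`
  (`IsCyclotomic.rootsOfUnityFixer_le_layerSubgroup_two`), so `ℚ_n ≅ ℚ(ζ_{2^{n+2}})⁺` (Mathlib `CMExtension.equivMaximalRealSubfield`); Weber (tree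
  `CyclotomicTwoPowerOddNarrowClassNumber`): `h(ℚ_n)` odd and every totally positive unit of `ℚ_n` is a square; `ℚ_n` has `≤ ℓ²` primes above `ℓ`
  uniformly in `n` (tree `CyclotomicTwoPowerPrimesOverBound`);
* §3: `L_n = j(K)·ℚ_n ≅ (K·ℚ_∞)_n` (`nonempty_algEquiv_layer_restrict_fieldRange_sup_layer`) is a CM field with `L_n⁺ ≅ ℚ_n`; Okazaki's Lemma 17
  (tree `CMFieldTwoRankOfTotPosSquares`) gives `#Cl(L_n)[2] = 2^{t_n − 1}`, and `t_n ≤ T(K) := ∑_{ℓ ∣ d_K} ℓ²` since a prime of `L_n⁺` ramified in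
  `L_n` lies over a rational prime ramified in `K` (base change of unramifiedness, `isUnramifiedIn_of_isUnramifiedIn_span`);
* §4: `rank₂ Cl((K·ℚ_∞)_n) ≤ T(K)` for all `n`, hence `μ = 0` in growth form by the tree's finite-level Washington Prop. 13.23
  (`classicalMuVanishes_of_forall_classGroupPRank_le`); any cyclotomic `κK` has the same layers (`classicalMuVanishes_iff_of_isCyclotomic`).

Main results: `natCard_twoTorsion_classGroup_fieldRange_sup_layer_le` (genus bound), `classGroupPRank_restrict_imaginaryQuadratic_two_le`,
`classicalMuVanishes_restrict_imaginaryQuadratic_two`, **`classicalMuVanishes_imaginaryQuadratic_cyclotomic_two`**.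

HONEST SCOPE.  Imaginary quadratic base fields, `p = 2`, cyclotomic `ℤ₂`-extension only; `λ` is not computed (Kida's formula is not claimed);
Ferrero–Washington in general stays a named fact.  Nothing here is specific to any summit beyond the motivation; BSD is not proved by any of this.

## References
* Y. Kida, *On cyclotomic ℤ₂-extensions of imaginary quadratic fields*, Tôhoku Math. J. 31 (1979) 91–96. [Kida1979Tohoku]
* B. Ferrero, *The cyclotomic ℤ₂-extension of imaginary quadratic fields*, Amer. J. Math. 102 (1980) 447–459. [Ferrero1980AJM]
* L. C. Washington, *Introduction to Cyclotomic Fields* (1997), §13.1, §13.3 Prop. 13.23, Thm. 10.4 / Cor. 10.5. [Washington1997]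
* R. Okazaki, Acta Arith. 92 (2000), §3 Lemma 17. [Okazaki2000]
-/

set_option autoImplicit false

noncomputable section

open scoped NumberField
open NumberField NumberField.IsCMField IsDedekindDomain Field IntermediateField Module
open Literature.NumberTheory.EllipticCurves Literature.NumberTheory.EllipticCurves.ZpExtension
  Literature.NumberTheory.GaloisRepresentations Literature.NumberTheory.NumberFields

namespace Literature.NumberTheory.IwasawaTheory

/-! ## §1 The layers `ℚ_n` of a cyclotomic `ℤ₂`-extension of `ℚ`: totally real, inside `ℚ(ζ_{2^{n+2}})` -/

section LayerRat

variable {p : ℕ} [Fact p.Prime]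

/-- Membership in a layer: `x ∈ K_n ↔ τ • x = x` for all `τ ∈ κ⁻¹(pⁿℤ_p)`. [cite: Washington1997, §13.1] -/
private theorem mem_layer_iff_smul' {K : Type} [Field K] (κ : ZpExtension K p) (n : ℕ) (x : AlgebraicClosure K) :
    x ∈ κ.layer n ↔ ∀ τ ∈ κ.layerSubgroup n, τ • x = x := by
  rw [ZpExtension.layer, IntermediateField.mem_fixedField_iff]
  constructor
  · intro h τ hτ
    exact h _ ⟨τ, hτ, rfl⟩
  · rintro h f ⟨τ, hτ, rfl⟩
    exact h τ hτ

/-- **The layers `ℚ_n` of a `ℤ_p`-extension of `ℚ` are totally real** (every `ℤ_p`-extension is unramified at the infinite places,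
tree `ZpExtension.isUnramifiedAtInfinitePlaces_layer`, and `ℚ` has no complex place). [cite: Washington1997, §13.1] -/
theorem isTotallyReal_layer_rat (κ : ZpExtension ℚ p) (n : ℕ) : IsTotallyReal ↥(κ.layer n) := by
  have hunr := κ.isUnramifiedAtInfinitePlaces_layer n
  refine ⟨fun w => ?_⟩
  rcases (InfinitePlace.isUnramified_iff.mp (hunr.isUnramified w)) with h | h
  · exact h
  · exact absurd h (InfinitePlace.not_isComplex_iff_isReal.mpr (IsTotallyReal.isReal _))

/-- **`ℚ_n ⊆ ℚ(ζ_{2^{n+2}})`** inside `ℚ̄` (`κ` cyclotomic, `ζ` a primitive `2^{n+2}`-th root of unity): an automorphism fixing `ζ` fixes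
`μ_{2^{n+2}}`, so lies in `κ⁻¹(2ⁿℤ₂) = Gal(ℚ̄/ℚ_n)` (`IsCyclotomic.rootsOfUnityFixer_le_layerSubgroup_two`); Krull. [cite: Washington1997, §13.1] -/
theorem layer_le_adjoin_of_isPrimitiveRoot {κ : ZpExtension ℚ 2} (hκ : κ.IsCyclotomic) (n : ℕ)
    {ζ : AlgebraicClosure ℚ} (hζ : IsPrimitiveRoot ζ (2 ^ (n + 2))) :
    κ.layer n ≤ ℚ⟮ζ⟯ := by
  -- the two `ℚ`-algebra structures on `ℚ̄` (`AlgebraicClosure.instAlgebra` / `DivisionRing.toRatAlgebra`) agree, but not reducibly: no `rw` across them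
  have hq : (DivisionRing.toRatAlgebra : Algebra ℚ (AlgebraicClosure ℚ)) = AlgebraicClosure.instAlgebra ℚ :=
    Subsingleton.elim _ _
  haveI : @Normal ℚ (AlgebraicClosure ℚ) _ _ DivisionRing.toRatAlgebra := by rw [hq]; infer_instance
  haveI : @Algebra.IsSeparable ℚ (AlgebraicClosure ℚ) _ _ DivisionRing.toRatAlgebra := by rw [hq]; infer_instance
  haveI : @IsGalois ℚ _ (AlgebraicClosure ℚ) _ DivisionRing.toRatAlgebra := ⟨⟩
  haveI : NeZero (2 ^ (n + 2)) := ⟨pow_ne_zero _ two_ne_zero⟩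
  intro x hx
  have key : x ∈ IntermediateField.fixedField (IntermediateField.fixingSubgroup ℚ⟮ζ⟯) := by
    rw [IntermediateField.mem_fixedField_iff]
    rintro σ hσ
    have hσζ : σ ζ = ζ := (IntermediateField.mem_fixingSubgroup_iff _ σ).mp hσ ζ (mem_adjoin_simple_self ℚ ζ)
    have hmem : σ ∈ rootsOfUnityFixer ℚ (2 ^ (n + 2)) := by
      refine (mem_rootsOfUnityFixer_iff).mpr fun t ht => ?_
      obtain ⟨i, -, rfl⟩ := hζ.eq_pow_of_pow_eq_one ht
      show σ (ζ ^ i) = ζ ^ i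
      rw [map_pow, hσζ]
    exact (mem_layer_iff_smul' κ n x).mp hx σ (hκ.rootsOfUnityFixer_le_layerSubgroup_two n hmem)
  exact (InfiniteGalois.fixedField_fixingSubgroup ℚ⟮ζ⟯).le key

end LayerRat

/-! ## §2 `ℚ_n` against the CM field `ℚ(ζ_{2^{n+2}})`: odd class number, totally positive units are squares, bounded decomposition -/

section LayerTwo

variable {κ : ZpExtension ℚ 2} (hκ : κ.IsCyclotomic) (n : ℕ)

include hκ in
/-- **Weber for the layer `ℚ_n`: `h(ℚ_n)` is odd and every totally positive unit of `ℚ_n` is the square of a unit** — `ℚ_n ⊆ C = ℚ(ζ_{2^{n+2}})`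
with `[C : ℚ_n] = 2`, `C` CM and `ℚ_n` totally real, so `ℚ_n ≅ C⁺` (`CMExtension.equivMaximalRealSubfield`); transport Weber's odd `h(C⁺)`, `h⁺(C⁺)`
(+ Hasse `forall_isSquare_of_totallyPositive_of_odd_narrowClassNumber`). [cite: Washington1997, Cor. 10.5 and §13.1] [cite: Okazaki2000, §3 Lemma 15] -/
theorem odd_classNumber_and_forall_isSquare_layer_two :
    (haveI : FiniteDimensional ℚ ↥(κ.layer n) := κ.finiteDimensional_layer_holds n
     haveI : NumberField ↥(κ.layer n) := NumberField.of_module_finite ℚ _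
     Odd (classNumber ↥(κ.layer n))) ∧
    ∀ u : (𝓞 ↥(κ.layer n))ˣ, (∀ σ : ↥(κ.layer n) →+* ℝ, 0 < σ ((u : 𝓞 ↥(κ.layer n)) : ↥(κ.layer n))) → IsSquare u := by
  haveI : FiniteDimensional ℚ ↥(κ.layer n) := κ.finiteDimensional_layer_holds n
  haveI : NumberField ↥(κ.layer n) := NumberField.of_module_finite ℚ _
  haveI : IsTotallyReal ↥(κ.layer n) := isTotallyReal_layer_rat κ n
  haveI : NeZero (((2 ^ (n + 2) : ℕ) : ℚ)) := ⟨by positivity⟩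
  obtain ⟨ζ, hζ⟩ := HasEnoughRootsOfUnity.exists_primitiveRoot (AlgebraicClosure ℚ) (2 ^ (n + 2))
  haveI : Algebra.IsAlgebraic ℚ (AlgebraicClosure ℚ) := AlgebraicClosure.isAlgebraic ℚ
  haveI hC : IsCyclotomicExtension {2 ^ (n + 2)} ℚ ↥ℚ⟮ζ⟯ := hζ.intermediateField_adjoin_isCyclotomicExtension ℚ
  haveI : FiniteDimensional ℚ ↥ℚ⟮ζ⟯ := IsCyclotomicExtension.finite {2 ^ (n + 2)} ℚ ↥ℚ⟮ζ⟯
  haveI : NumberField ↥ℚ⟮ζ⟯ := NumberField.of_module_finite ℚ _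
  haveI : IsCMField ↥ℚ⟮ζ⟯ := isCMField_of_isCyclotomicExtension_two_pow ↥ℚ⟮ζ⟯ n
  have hle : κ.layer n ≤ ℚ⟮ζ⟯ := layer_le_adjoin_of_isPrimitiveRoot hκ n hζ
  letI : Algebra ↥(κ.layer n) ↥ℚ⟮ζ⟯ := (IntermediateField.inclusion hle).toRingHom.toAlgebra
  haveI : IsScalarTower ℚ ↥(κ.layer n) ↥ℚ⟮ζ⟯ := IsScalarTower.of_algebraMap_eq fun _ => rfl
  haveI : Module.Free ↥(κ.layer n) ↥ℚ⟮ζ⟯ := Module.Free.of_divisionRing _ _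
  haveI : Algebra.IsQuadraticExtension ↥(κ.layer n) ↥ℚ⟮ζ⟯ := by
    refine { finrank_eq_two' := ?_ }
    have h1 := Module.finrank_mul_finrank ℚ ↥(κ.layer n) ↥ℚ⟮ζ⟯
    rw [κ.finrank_layer_holds n, IsCyclotomicExtension.Rat.finrank (2 ^ (n + 2)) ↥ℚ⟮ζ⟯,
      show n + 2 = (n + 1) + 1 by ring, Nat.totient_prime_pow_succ Nat.prime_two] at h1
    have h2 : 2 ^ n * Module.finrank ↥(κ.layer n) ↥ℚ⟮ζ⟯ = 2 ^ n * 2 := by rw [h1]; ring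
    exact Nat.eq_of_mul_eq_mul_left (pow_pos two_pos n) h2
  let e := CMExtension.equivMaximalRealSubfield ↥(κ.layer n) ↥ℚ⟮ζ⟯
  refine ⟨odd_classNumber_of_ringEquiv e.symm
      (odd_classNumber_maximalRealSubfield_of_isCyclotomicExtension_two_pow ↥ℚ⟮ζ⟯ n), ?_⟩
  exact forall_isSquare_of_totallyPositive_of_ringEquiv e.symm
    (forall_isSquare_of_totallyPositive_of_odd_narrowClassNumber (maximalRealSubfield ↥ℚ⟮ζ⟯)
      (odd_narrowClassNumber_maximalRealSubfield_of_isCyclotomicExtension_two_pow ↥ℚ⟮ζ⟯ n))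

include hκ in
/-- **At most `ℓ²` primes of `ℚ_n` above each rational prime `ℓ`, uniformly in `n`** (`ℚ_n ⊆ ℚ(ζ_{2^{n+2}})`, tree
`ncard_primesOver_le_sq_of_algebra_isCyclotomicExtension_two_pow`). [cite: Washington1997, Thm. 2.13 and §13.1] -/
theorem ncard_primesOver_layer_two_le_sq {ℓ : ℕ} (hℓ : ℓ.Prime) :
    (haveI : FiniteDimensional ℚ ↥(κ.layer n) := κ.finiteDimensional_layer_holds n
     haveI : NumberField ↥(κ.layer n) := NumberField.of_module_finite ℚ _
     ((Ideal.span {(ℓ : ℤ)}).primesOver (𝓞 ↥(κ.layer n))).ncard) ≤ ℓ ^ 2 := by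
  haveI : FiniteDimensional ℚ ↥(κ.layer n) := κ.finiteDimensional_layer_holds n
  haveI : NumberField ↥(κ.layer n) := NumberField.of_module_finite ℚ _
  haveI : NeZero (((2 ^ (n + 2) : ℕ) : ℚ)) := ⟨by positivity⟩
  obtain ⟨ζ, hζ⟩ := HasEnoughRootsOfUnity.exists_primitiveRoot (AlgebraicClosure ℚ) (2 ^ (n + 2))
  haveI : Algebra.IsAlgebraic ℚ (AlgebraicClosure ℚ) := AlgebraicClosure.isAlgebraic ℚ
  haveI hC : IsCyclotomicExtension {2 ^ (n + 2)} ℚ ↥ℚ⟮ζ⟯ := hζ.intermediateField_adjoin_isCyclotomicExtension ℚ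
  haveI : FiniteDimensional ℚ ↥ℚ⟮ζ⟯ := IsCyclotomicExtension.finite {2 ^ (n + 2)} ℚ ↥ℚ⟮ζ⟯
  haveI : NumberField ↥ℚ⟮ζ⟯ := NumberField.of_module_finite ℚ _
  have hle : κ.layer n ≤ ℚ⟮ζ⟯ := layer_le_adjoin_of_isPrimitiveRoot hκ n hζ
  letI : Algebra ↥(κ.layer n) ↥ℚ⟮ζ⟯ := (IntermediateField.inclusion hle).toRingHom.toAlgebra
  exact ncard_primesOver_le_sq_of_algebra_isCyclotomicExtension_two_pow ↥ℚ⟮ζ⟯ n ↥(κ.layer n) hℓ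

end LayerTwo

/-! ## §3 The CM field `L_n = j(K)·ℚ_n` of an imaginary quadratic `K`: `#Cl(L_n)[2] = 2^{t_n − 1} ≤ 2^{T(K)}` -/

section Compositum

variable {κ : ZpExtension ℚ 2} (hκ : κ.IsCyclotomic) (K : Type) [Field K] [NumberField K] (hK : IsImaginaryQuadratic K)
  (j : K →ₐ[ℚ] AlgebraicClosure ℚ) (n : ℕ)

/-- `√2 ∉ K` for an imaginary quadratic `K` (`d_K < 0`, while `x² = 2`, `x ∉ ℚ` would give `d_K = 2q² > 0`;
copy of the Summits-side `TwoAdicShapiroLattice.sq_ne_two`). [cite: Washington1997, §13.1] -/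
private theorem sq_ne_two' (hK : IsImaginaryQuadratic K) (x : K) : x ^ 2 ≠ 2 := by
  intro hx
  have hx' : x ^ 2 = algebraMap ℚ K 2 := by rw [hx, map_ofNat]
  have hxK : x ∉ Set.range (algebraMap ℚ K) := by
    rintro ⟨q, rfl⟩
    have hq : (q : ℝ) ^ 2 = 2 := by
      rw [← map_pow] at hx'
      have := (algebraMap ℚ K).injective hx'
      exact_mod_cast congrArg (fun r : ℚ ↦ (r : ℝ)) this
    refine irrational_sqrt_two ⟨|q|, ?_⟩
    rw [Rat.cast_abs, ← Real.sqrt_sq_eq_abs, hq]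
  obtain ⟨q, hq0, hq⟩ := NumberField.exists_discr_eq_mul_sq hK.1 hxK hx'
  have hneg : (NumberField.discr K : ℚ) < 0 := by exact_mod_cast hK.discr_neg
  have hpos : (0 : ℚ) < 2 * q ^ 2 := by positivity
  linarith

include hκ hK in
/-- **`κ ∘ res_{K/ℚ}` is onto** for an imaginary quadratic `K` (`[K : ℚ] = 2`, `√2 ∉ K`), so `κ.restrict K _` is the `ℤ₂`-extension
`K·ℚ_∞/K`. [cite: Washington1997, §13.1] -/
theorem surjective_comp_absGaloisRestrict_imaginaryQuadratic_two :
    Function.Surjective (κ.toContinuousMonoidHom.comp (absGaloisRestrict ℚ K)) :=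
  surjective_comp_absGaloisRestrict_of_forall_sq_ne_two κ K hκ (by rw [hK.1]; decide) (sq_ne_two' K hK)

/-- The rational prime under a maximal ideal of a ring of integers. [folklore] -/
private theorem exists_prime_liesOver' {L : Type*} [Field L] [NumberField L] (P : Ideal (𝓞 L)) [P.IsMaximal] :
    ∃ q : ℕ, q.Prime ∧ P.LiesOver (Ideal.span {(q : ℤ)}) := by
  have hP0 : P ≠ ⊥ := Ring.ne_bot_of_isMaximal_of_not_isField ‹_› (RingOfIntegers.not_isField L)
  haveI : (P.under ℤ).IsPrime := Ideal.IsPrime.under ℤ P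
  have hPZ0 : P.under ℤ ≠ ⊥ := mt Ideal.eq_bot_of_comap_eq_bot hP0
  set g := Submodule.IsPrincipal.generator (P.under ℤ) with hgdef
  have hg : Ideal.span {g} = P.under ℤ := Ideal.span_singleton_generator (P.under ℤ)
  have hg0 : g ≠ 0 := fun h => hPZ0 (by rw [← hg, h, Ideal.span_singleton_eq_bot])
  have hgprime : Prime g := (Ideal.span_singleton_prime hg0).mp (hg.symm ▸ inferInstance)
  refine ⟨g.natAbs, Int.prime_iff_natAbs_prime.mp hgprime, ⟨?_⟩⟩
  rw [Int.span_natAbs, hg]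

include hκ hK in
/-- **Genus bound for `L_n = j(K)·ℚ_n`** (`K` imaginary quadratic, `j : K → ℚ̄`, `ℚ_n` a layer of a cyclotomic `ℤ₂`-extension of `ℚ`): `L_n` is CM
with `L_n⁺ ≅ ℚ_n` and **`#Cl(L_n)[2] ≤ 2^{T(K)}`, `T(K) = ∑_{ℓ ∣ d_K} ℓ²`** independent of `n` — Okazaki's Lemma 17 (`#Cl(L_n)[2] = 2^{t−1}`; Weber's
inputs on `ℚ_n`), the `t` primes of `L_n⁺` ramified in `L_n` lie over rational primes ramified in `K`, and `ℚ_n` has `≤ ℓ²` primes above `ℓ`.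
[cite: Kida1979Tohoku, Thm. 1 (proof)] [cite: Ferrero1980AJM, §2] [cite: Okazaki2000, §3 Lemma 17] [cite: Washington1997, §13.1] -/
theorem natCard_twoTorsion_classGroup_fieldRange_sup_layer_le :
    Nat.card {c : ClassGroup (𝓞 ↥(j.fieldRange ⊔ κ.layer n)) // c ^ 2 = 1} ≤
      2 ^ (∑ ℓ ∈ (NumberField.discr K).natAbs.primeFactors, ℓ ^ 2) := by
  classical
  haveI : FiniteDimensional ℚ ↥(κ.layer n) := κ.finiteDimensional_layer_holds n
  haveI : NumberField ↥(κ.layer n) := NumberField.of_module_finite ℚ _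
  haveI : IsTotallyReal ↥(κ.layer n) := isTotallyReal_layer_rat κ n
  haveI : NumberField ↥(j.fieldRange ⊔ κ.layer n) := numberField_fieldRange_sup_layer κ K j n
  have hle : κ.layer n ≤ j.fieldRange ⊔ κ.layer n := le_sup_right
  letI algL : Algebra ↥(κ.layer n) ↥(j.fieldRange ⊔ κ.layer n) := (IntermediateField.inclusion hle).toRingHom.toAlgebra
  haveI : IsScalarTower ℚ ↥(κ.layer n) ↥(j.fieldRange ⊔ κ.layer n) := IsScalarTower.of_algebraMap_eq fun _ => rfl
  let eK : K →+* ↥(j.fieldRange ⊔ κ.layer n) :=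
    (j : K →+* AlgebraicClosure ℚ).codRestrict (j.fieldRange ⊔ κ.layer n) fun x =>
      (le_sup_left : j.fieldRange ≤ j.fieldRange ⊔ κ.layer n) (j.mem_fieldRange.mpr ⟨x, rfl⟩)
  letI algK : Algebra K ↥(j.fieldRange ⊔ κ.layer n) := eK.toAlgebra
  haveI : IsTotallyComplex K := hK.2
  haveI : IsTotallyComplex ↥(j.fieldRange ⊔ κ.layer n) := isTotallyComplex_of_algebra (F := K) _
  have hsurj := surjective_comp_absGaloisRestrict_imaginaryQuadratic_two hκ K hK
  obtain ⟨eF⟩ := nonempty_algEquiv_layer_restrict_fieldRange_sup_layer κ K hsurj j n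
  have hdegF : Module.finrank ℚ ↥(j.fieldRange ⊔ κ.layer n) = 2 ^ n * 2 := by
    have h1 : Module.finrank ℚ ↥((κ.restrict K hsurj).layer n) = Module.finrank ℚ ↥(j.fieldRange ⊔ κ.layer n) :=
      eF.toLinearEquiv.finrank_eq
    have h2 := finrank_layer_restrict κ K hsurj n
    rw [hK.1] at h2
    omega
  haveI : Module.Free ↥(κ.layer n) ↥(j.fieldRange ⊔ κ.layer n) := Module.Free.of_divisionRing _ _
  haveI : Algebra.IsQuadraticExtension ↥(κ.layer n) ↥(j.fieldRange ⊔ κ.layer n) := by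
    refine { finrank_eq_two' := ?_ }
    have h1 := Module.finrank_mul_finrank ℚ ↥(κ.layer n) ↥(j.fieldRange ⊔ κ.layer n)
    rw [κ.finrank_layer_holds n, hdegF] at h1
    exact Nat.eq_of_mul_eq_mul_left (pow_pos two_pos n) h1
  haveI : IsCMField ↥(j.fieldRange ⊔ κ.layer n) := IsCMField.ofCMExtension ↥(κ.layer n) _
  let e := CMExtension.equivMaximalRealSubfield ↥(κ.layer n) ↥(j.fieldRange ⊔ κ.layer n)
  -- Okazaki on `L_n` (Weber's inputs on `ℚ_n`, transported to `L_n⁺` along `e`)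
  obtain ⟨hoddL, hsqL⟩ := odd_classNumber_and_forall_isSquare_layer_two hκ n
  have hoddF : Odd (classNumber (maximalRealSubfield ↥(j.fieldRange ⊔ κ.layer n))) := odd_classNumber_of_ringEquiv e hoddL
  have hsqF := forall_isSquare_of_totallyPositive_of_ringEquiv e hsqL
  rw [IsCMField.card_twoTorsion_classGroup_eq_two_pow_of_odd_of_forall_isSquare _ hoddF hsqF]
  refine Nat.pow_le_pow_right two_pos (le_trans (Nat.sub_le _ 1) ?_)
  -- notation: `L = j(K)·ℚ_n`, `Fp = L⁺`
  set Fp := maximalRealSubfield ↥(j.fieldRange ⊔ κ.layer n) with hFp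
  set P := (NumberField.discr K).natAbs.primeFactors with hP
  have hdisc : NumberField.discr K ≠ 0 := NumberField.discr_ne_zero K
  haveI : Module.Free ℚ K := Module.Free.of_divisionRing _ _
  haveI : Algebra.IsQuadraticExtension ℚ K := { finrank_eq_two' := hK.1 }
  haveI : IsGaloisGroup (↥(j.fieldRange ⊔ κ.layer n) ≃ₐ[↥Fp] ↥(j.fieldRange ⊔ κ.layer n)) (𝓞 ↥Fp)
      (𝓞 ↥(j.fieldRange ⊔ κ.layer n)) :=
    IsGaloisGroup.of_isFractionRing _ _ _ (↥Fp) ↥(j.fieldRange ⊔ κ.layer n)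
  -- `L` is generated over `L⁺` by the image of `K` (otherwise `K` would embed in the totally real `L⁺`)
  have hgen : IntermediateField.adjoin (↥Fp) (Set.range (algebraMap K ↥(j.fieldRange ⊔ κ.layer n))) = ⊤ := by
    set E := IntermediateField.adjoin (↥Fp) (Set.range (algebraMap K ↥(j.fieldRange ⊔ κ.layer n))) with hE
    have h2 : (Module.finrank (↥Fp) ↥(j.fieldRange ⊔ κ.layer n)).Prime := by
      rw [(IsCMField.isQuadraticExtension ↥(j.fieldRange ⊔ κ.layer n)).finrank_eq_two]; exact Nat.prime_two
    haveI := IntermediateField.isSimpleOrder_of_finrank_prime (↥Fp) ↥(j.fieldRange ⊔ κ.layer n) h2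
    rcases eq_bot_or_eq_top E with h | h
    · exfalso -- `K → E = ⊥ ≅ Fp` would make `K` totally real
      have hmemFp : ∀ x : K, algebraMap K ↥(j.fieldRange ⊔ κ.layer n) x ∈ Fp := fun x => by
        obtain ⟨y, hy⟩ := IntermediateField.mem_bot.mp (h ▸ IntermediateField.subset_adjoin _ _ ⟨x, rfl⟩ :
          algebraMap K ↥(j.fieldRange ⊔ κ.layer n) x ∈ (⊥ : IntermediateField ↥Fp ↥(j.fieldRange ⊔ κ.layer n)))
        exact hy ▸ y.2
      letI : Algebra K ↥Fp := ((algebraMap K ↥(j.fieldRange ⊔ κ.layer n)).codRestrict Fp hmemFp).toAlgebra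
      haveI : IsScalarTower ℚ K ↥Fp := IsScalarTower.of_algebraMap_eq' (Subsingleton.elim _ _)
      haveI : Algebra.IsAlgebraic K ↥Fp :=
        Algebra.IsAlgebraic.extendScalars (R := ℚ) (S := K) (A := ↥Fp) (algebraMap ℚ K).injective
      haveI : IsTotallyReal K := IsTotallyReal.of_algebra K ↥Fp
      obtain ⟨w⟩ := (inferInstance : Nonempty (InfinitePlace K))
      exact (InfinitePlace.not_isReal_iff_isComplex.mpr (IsTotallyComplex.isComplex w)) (IsTotallyReal.isReal w)
    · exact h
  -- every ramified prime of `L⁺` lies over a prime factor of `d_K`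
  have hcover : {v : HeightOneSpectrum (𝓞 ↥Fp) | v.asIdeal.ramificationIdxIn (𝓞 ↥(j.fieldRange ⊔ κ.layer n)) ≠ 1} ⊆
      ⋃ ℓ ∈ P, {v : HeightOneSpectrum (𝓞 ↥Fp) | v.asIdeal ∈ (Ideal.span {(ℓ : ℤ)}).primesOver (𝓞 ↥Fp)} := by
    intro v hv
    haveI := v.isPrime
    obtain ⟨⟨Q, hQ, hQv⟩⟩ := v.asIdeal.nonempty_primesOver (S := 𝓞 ↥(j.fieldRange ⊔ κ.layer n))
    haveI := hQ; haveI := hQv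
    haveI : Q.IsMaximal := hQ.isMaximal (Ideal.ne_bot_of_liesOver_of_ne_bot v.ne_bot Q)
    obtain ⟨q, hq, hQq⟩ := exists_prime_liesOver' Q
    haveI := hQq; haveI : Fact q.Prime := ⟨hq⟩
    have hvq : v.asIdeal.LiesOver (Ideal.span {(q : ℤ)}) := Ideal.LiesOver.tower_bot Q v.asIdeal (Ideal.span {(q : ℤ)})
    have hvq' : ((q : ℕ) : 𝓞 ↥Fp) ∈ v.asIdeal := by
      have : ((q : ℤ) : ℤ) ∈ Ideal.span {(q : ℤ)} := Ideal.mem_span_singleton_self _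
      rw [hvq.over, Ideal.under_def, Ideal.mem_comap] at this
      simpa using this
    -- `v` is NOT unramified in `L`, hence `q` ramifies in `K`
    have hnot : ¬ Algebra.IsUnramifiedIn (𝓞 ↥(j.fieldRange ⊔ κ.layer n)) v.asIdeal := fun hunr =>
      hv ((Ideal.ramificationIdxIn_eq_ramificationIdx v.asIdeal Q
        (↥(j.fieldRange ⊔ κ.layer n) ≃ₐ[↥Fp] ↥(j.fieldRange ⊔ κ.layer n))).trans
          (hunr.ramificationIdx_eq_one hQv))
    have hqK : ¬ Algebra.IsUnramifiedIn (𝓞 K) (Ideal.span {(q : ℤ)}) := fun hK' =>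
      hnot (isUnramifiedIn_of_isUnramifiedIn_span hgen hq hK' v hvq')
    have hqd : (q : ℤ) ∣ NumberField.discr K := by
      by_contra hnd
      exact hqK ((NumberField.not_dvd_discr_iff_isUnramifiedIn K (𝓞 K) (Nat.prime_iff_prime_int.mp hq)).mp hnd)
    refine Set.mem_biUnion (x := q) ?_ ?_
    · exact Nat.mem_primeFactors.mpr ⟨hq, Int.natAbs_dvd_natAbs.mpr hqd |>.trans (by simp), Int.natAbs_ne_zero.mpr hdisc⟩
    · exact ⟨v.isPrime, hvq⟩
  have hfin : ∀ ℓ ∈ P, ({v : HeightOneSpectrum (𝓞 ↥Fp) | v.asIdeal ∈ (Ideal.span {(ℓ : ℤ)}).primesOver (𝓞 ↥Fp)}).Finite ∧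
      ({v : HeightOneSpectrum (𝓞 ↥Fp) | v.asIdeal ∈ (Ideal.span {(ℓ : ℤ)}).primesOver (𝓞 ↥Fp)}).ncard ≤ ℓ ^ 2 := by
    intro ℓ hℓ
    have hℓp : ℓ.Prime := Nat.prime_of_mem_primeFactors hℓ
    haveI : Fact ℓ.Prime := ⟨hℓp⟩
    haveI : (Ideal.span {(ℓ : ℤ)}).IsMaximal := Int.ideal_span_isMaximal_of_prime ℓ
    have hinj : Set.InjOn (fun v : HeightOneSpectrum (𝓞 ↥Fp) => v.asIdeal)
        {v | v.asIdeal ∈ (Ideal.span {(ℓ : ℤ)}).primesOver (𝓞 ↥Fp)} := fun v _ v' _ h => HeightOneSpectrum.ext h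
    have hmaps : Set.MapsTo (fun v : HeightOneSpectrum (𝓞 ↥Fp) => v.asIdeal)
        {v | v.asIdeal ∈ (Ideal.span {(ℓ : ℤ)}).primesOver (𝓞 ↥Fp)} ((Ideal.span {(ℓ : ℤ)}).primesOver (𝓞 ↥Fp)) := fun v hv => hv
    have hfinT : ((Ideal.span {(ℓ : ℤ)}).primesOver (𝓞 ↥Fp)).Finite := IsDedekindDomain.primesOver_finite _ _
    refine ⟨Set.Finite.of_injOn hmaps hinj hfinT, ?_⟩
    calc ({v : HeightOneSpectrum (𝓞 ↥Fp) | v.asIdeal ∈ (Ideal.span {(ℓ : ℤ)}).primesOver (𝓞 ↥Fp)}).ncard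
        ≤ ((Ideal.span {(ℓ : ℤ)}).primesOver (𝓞 ↥Fp)).ncard := Set.ncard_le_ncard_of_injOn _ hmaps hinj hfinT
      _ = ((Ideal.span {(ℓ : ℤ)}).primesOver (𝓞 ↥(κ.layer n))).ncard := (ncard_primesOver_eq_of_ringEquiv e ℓ).symm
      _ ≤ ℓ ^ 2 := ncard_primesOver_layer_two_le_sq hκ n hℓp
  calc {v : HeightOneSpectrum (𝓞 ↥Fp) | v.asIdeal.ramificationIdxIn (𝓞 ↥(j.fieldRange ⊔ κ.layer n)) ≠ 1}.ncard
      ≤ (⋃ ℓ ∈ P, {v : HeightOneSpectrum (𝓞 ↥Fp) | v.asIdeal ∈ (Ideal.span {(ℓ : ℤ)}).primesOver (𝓞 ↥Fp)}).ncard :=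
        Set.ncard_le_ncard hcover (Set.Finite.biUnion P.finite_toSet fun ℓ hℓ => (hfin ℓ hℓ).1)
    _ ≤ ∑ ℓ ∈ P, ({v : HeightOneSpectrum (𝓞 ↥Fp) | v.asIdeal ∈ (Ideal.span {(ℓ : ℤ)}).primesOver (𝓞 ↥Fp)}).ncard :=
        Finset.set_ncard_biUnion_le P _
    _ ≤ ∑ ℓ ∈ P, ℓ ^ 2 := Finset.sum_le_sum fun ℓ hℓ => (hfin ℓ hℓ).2

end Compositum

/-! ## §4 `μ₂ = 0` for `K·ℚ_∞/K` and for every cyclotomic `ℤ₂`-extension of an imaginary quadratic `K` -/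

section MuZero

variable {κ : ZpExtension ℚ 2} (hκ : κ.IsCyclotomic) (K : Type) [Field K] [NumberField K] (hK : IsImaginaryQuadratic K)

/-- **Uniform `2`-rank bound up the tower `K·ℚ_∞/K`** for an imaginary quadratic `K`:
`rank₂ Cl((K·ℚ_∞)_m) ≤ T(K) = ∑_{ℓ ∣ d_K} ℓ²` for every `m` (`#Cl[2] = 2^{rank₂}`, the layer `(K·ℚ_∞)_m ≅ j(K)·ℚ_m ⊆ ℚ̄`, and the
genus bound `natCard_twoTorsion_classGroup_fieldRange_sup_layer_le`). [cite: Kida1979Tohoku, Thm. 1 (proof)] [cite: Ferrero1980AJM, §2]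
[cite: Washington1997, §13.3 (proof of Prop. 13.23)] -/
theorem classGroupPRank_restrict_imaginaryQuadratic_two_le (m : ℕ) :
    classGroupPRank (κ.restrict K (surjective_comp_absGaloisRestrict_imaginaryQuadratic_two hκ K hK)) m ≤
      ∑ ℓ ∈ (NumberField.discr K).natAbs.primeFactors, ℓ ^ 2 := by
  have hsurj := surjective_comp_absGaloisRestrict_imaginaryQuadratic_two hκ K hK
  obtain ⟨eF⟩ := nonempty_algEquiv_layer_restrict_fieldRange_sup_layer κ K hsurj (absEmbedding ℚ K) m
  have h1 := natCard_torsion_classGroup_layer_eq (κ.restrict K hsurj) m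
  have h2 := natCard_twoTorsion_classGroup_eq_of_ringEquiv eF.toRingEquiv
  have h3 := natCard_twoTorsion_classGroup_fieldRange_sup_layer_le hκ K hK (absEmbedding ℚ K) m
  have h4 : 2 ^ classGroupPRank (κ.restrict K hsurj) m ≤ 2 ^ ∑ ℓ ∈ (NumberField.discr K).natAbs.primeFactors, ℓ ^ 2 := by
    rw [← h1, h2]
    exact h3
  exact (Nat.pow_le_pow_iff_right Nat.one_lt_two).mp h4

/-- **`μ₂ = 0` for `K·ℚ_∞/K`**, `K` imaginary quadratic, `ℚ_∞/ℚ` a cyclotomic `ℤ₂`-extension restricted to `Γ_K` (bounded `2`-ranks ⟹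
`μ = 0`, Washington Prop. 13.23 at finite level). [cite: Kida1979Tohoku, Thm. 1] [cite: Ferrero1980AJM, Thm.] [cite: Washington1997, §13.3 Prop. 13.23] -/
theorem classicalMuVanishes_restrict_imaginaryQuadratic_two :
    ClassicalMuVanishes (κ.restrict K (surjective_comp_absGaloisRestrict_imaginaryQuadratic_two hκ K hK)) :=
  classicalMuVanishes_of_forall_classGroupPRank_le _ (classGroupPRank_restrict_imaginaryQuadratic_two_le hκ K hK)

/-- **Ferrero–Washington for imaginary quadratic fields at `p = 2` (Kida 1979, Ferrero 1980), as a tree theorem**: for every imaginary quadratic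
`K` and every CYCLOTOMIC `ℤ₂`-extension `κK` of `K`, `μ(K_∞/K) = 0` in growth form (`∃ λ ν n₀, ∀ n ≥ n₀, ord₂ h(K_n) = λ n + ν`): `κK` has the same
layers as the restriction of `ℚ`'s cyclotomic `ℤ₂`-extension (`classicalMuVanishes_iff_of_isCyclotomic`), which has `μ = 0` by genus theory.
[cite: Kida1979Tohoku, Thm. 1] [cite: Ferrero1980AJM, Thm.] [cite: FerreroWashington1979, Thm. (abelian K; here K imaginary quadratic, p = 2)] -/
theorem classicalMuVanishes_imaginaryQuadratic_cyclotomic_two (K : Type) [Field K] [NumberField K] (hK : IsImaginaryQuadratic K)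
    (κK : ZpExtension K 2) (hκK : κK.IsCyclotomic) : ClassicalMuVanishes κK := by
  have hcyc := CyclotomicZp.isCyclotomic_zpExtension 2
  have hsurj := surjective_comp_absGaloisRestrict_imaginaryQuadratic_two hcyc K hK
  exact (classicalMuVanishes_iff_of_isCyclotomic κK _ hκK
    (isCyclotomic_restrict (CyclotomicZp.zpExtension 2) hcyc K hsurj)).mpr
      (classicalMuVanishes_restrict_imaginaryQuadratic_two hcyc K hK)

end MuZero

end Literature.NumberTheory.IwasawaTheory

end
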